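import Literature.AnabelianGeometry.EtaleTheta.ConstantsDictionaryWitness

/-!
# [EtTh] §5 ↔ §3: the constants-toy §5 datum WITH ITS SECTIONS — `datum′` = abc-iut-L2-t11's `CnstToy.datum` with
# `s^trv_N := s^⊓-gp_N := inr` and `s^⊔-gp_N := inr|_{H_{B_N}}` (the TERMS for the full-`Facts` non-vacuity witness)

S. Mochizuki, *The étale theta function and its Frobenioid-theoretic manifestations*, Publ. RIMS **45** (2009) [MochizukiEtTh2009],
§5 pp.330–331 (PDF pp.104–105): "the group homomorphism `s^trv_N : Aut_D(A_N^bs) → Aut_C(A_N)` arising from a base-Frobenius pair of `A_N`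
[cf. [FrdI], Proposition 5.6]", "`s^trv_N` … determines unique group homomorphisms `s^⊓-gp_N : Aut_D(B_N^bs) → Aut_C(B_N)`,
`s^⊔-gp_N : H_{B_N} → Aut_C(B_N)` such that `s^⊓-gp_N(g) ∘ s^⊓_N = s^⊓_N ∘ (s^trv_N|…)(g)`, `s^⊔-gp_N(h) ∘ s^⊔_N = s^⊔_N ∘ (s^trv_N|…)(h)`";
Lemma 5.8 p.331 (PDF p.105).

abc-iut cell, layer L2, seat abc-iut-w5-d013 (gen 6), row «CnstToy datum′ FULL-Facts NV» (abc-iut-L2-lead R562 (c) / R612 / R632 / R666 GO).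
ADDITIVE, class (b): ONE new TERM and five `rfl` lemmas; nothing landed is edited or restated; abc-iut-L2-t11's
`ConstantsDictionaryWitness.lean` (`CnstToy.datum`, `stub`, `subquot`, `rho`, `sgpCap`, `constEmb`, …) is consumed BY NAME.

WHY A SECOND DATUM.  abc-iut-L2-t11's `CnstToy.datum Cu μ hC hS` (a §5 datum over the theta setting's OWN §2 model
`Cu.thetaEnvData μ hC hS`, with `Aut_C(B_N) := μ_N(J_N) ⋊ Γ`, `Γ := Im(G_K → Aut(J_N/ℚ_p))`) takes `s^trv_N := 1` and `s^⊔-gp_N := 1`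
(its docstring: "`SgpCupSection` and the full bundle `Facts` are NOT claimed here").  With `s^trv_N = 1` the section property
`StrvSection` («`(s^trv_N(g))^bs = g`») FAILS as soon as `Γ ≠ 1` (kernel theorem `CnstToy.strvSection_datum_iff` in the proof-only
companion).  `datum′` keeps EVERY other field of `datum` (same `C`, `D`, `Π`-block, `ρ`, units, birational units, constants, `Θ̈ := 1`,
`s^⊓_N = s^⊔_N = 𝟙`, `s^⊓-gp_N := inr`) and sets `s^trv_N := inr` (the canonical splitting `Γ → μ_N(J_N) ⋊ Γ`, a section of the base
projection — print's «arising from a base-Frobenius pair», [FrdI] Prop. 5.6, here for the trivial line bundle: `A_⊚ = A_N = B_N`) and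
`s^⊔-gp_N := inr|_{H_{B_N}}` (so the bi-Kummer difference cocycle `s^⊔-gp_N · (s^⊓-gp_N)⁻¹` is TRIVIAL — consistent with `Θ̈ := 1`),
which is exactly what the printed defining relations force when `s^⊓_N = s^⊔_N = 𝟙`.  The proof-only companion
`Discharge/Sec5ConstantsDictionaryWitnessFullFacts.lean` proves the FULL bundle `ThetaFrobenioid.Facts` for `datum′` (all eight fields,
binder-free over every theta setting's §2 model and at the record model `modelχ`), together with the Lemma 5.8 package that abc-iut-L2-t11
proved for `datum` (transported along the shared fields).
HONEST LABEL: terms of a consistency / non-vacuity witness.  `datum′` is a TOY — NOT the tempered Frobenioid of a curve (trivial divisor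
monoids, `A_⊚ = A_N = B_N`, trivial theta function and bi-Kummer cocycle); nothing of [EtTh] is asserted; typed ≠ proved; no side is taken on
anything downstream ([IUTchIII] Cor. 3.12).
-/

noncomputable section

namespace Literature.AnabelianGeometry.EtaleTheta

open CategoryTheory Literature.AnabelianGeometry.SemiGraphs IntermediateField

namespace ThetaFrobenioid

namespace CnstToy

variable {p : ℕ} [Fact p.Prime] {D : ThetaSetting p} {N : ℕ+} {E : D.EtaleThetaData} {l : ℕ}
  (Cu : E.DoubleUnderline l) (μ : D.CyclotomeMod l N) (hC : D.Compat) (hS : D.Sec2Hyps)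

/-- **The constants-toy §5 datum WITH SECTIONS** over the setting's own §2 model (abc-iut-L2-t4's `ThetaFrobenioid.ofThetaEnvData`, exactly
as abc-iut-L2-t11's `CnstToy.datum` — `Π`-block `:= T`'s, `C := B(μ_N(J_N) ⋊ Γ)`, `D := BΓ`, `A_⊚ = A_N = B_N = ⋆`, `s^⊓_N = s^⊔_N = 𝟙`,
`ρ := Γ-restriction ∘ aug`, `s^⊓-gp_N := inr`, constants `K^× ↪ J_N^×`, `Θ̈ := 1` — EXCEPT `s^trv_N := inr` ("arising from a base-Frobenius
pair of `A_N` [cf. [FrdI], Proposition 5.6]", p.330) and `s^⊔-gp_N := inr|_{H_{B_N}}` (the defining relation of p.331 with `s^⊔_N = 𝟙`)).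
[cite: MochizukiEtTh2009, §5 p.330–331 (PDF pp.104–105)] -/
def datum' : ThetaFrobenioid.{0} (SingleObj (G D N)) (SingleObj (Gam D N)) :=
  ThetaFrobenioid.ofThetaEnvData (stub D N) (subquot D N) l Cu.l_odd N (Cu.thetaEnvData μ hC hS)
    (SingleObj.star _) (SingleObj.star _) (SingleObj.star _) (𝟙 _) (𝟙 _) rfl
    ⟨rfl, show IsIso ((Toy.pre (π D N)).base.map (𝟙 _)) from inferInstance⟩
    ⟨rfl, show IsIso ((Toy.pre (π D N)).base.map (𝟙 _)) from inferInstance⟩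
    (rho Cu μ hC hS) (rho_surjective Cu μ hC hS) (isOpen_ker_rho Cu μ hC hS)
    (sgpCap (D := D) (N := N)) (sgpCap (D := D) (N := N))
    ((sgpCap (D := D) (N := N)).comp (Subgroup.subtype _))
    D.K (constEmb D N) (constEmb_injective D N) 1

/-- `s^trv_N` of `datum′` is the canonical splitting `inr` (= the toy's `s^⊓-gp_N`). [cite: MochizukiEtTh2009, §5 p.330 (PDF p.104)] -/
theorem datum'_strv : (datum' Cu μ hC hS).strv = sgpCap (D := D) (N := N) := rfl

/-- `s^⊓-gp_N` of `datum′` is that of `datum` (`inr`). [cite: MochizukiEtTh2009, §5 p.331 (PDF p.105)] -/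
theorem datum'_sgpCap : (datum' Cu μ hC hS).sgpCap = (datum Cu μ hC hS).sgpCap := rfl

/-- `s^⊔-gp_N(h)` of `datum′` is `inr(h)` for `h ∈ H_{B_N}`. [cite: MochizukiEtTh2009, §5 p.331 (PDF p.105)] -/
theorem datum'_sgpCup_apply (h : (datum' Cu μ hC hS).HB) :
    (datum' Cu μ hC hS).sgpCup h = sgpCap (D := D) (N := N) (h : Aut ((datum' Cu μ hC hS).base.obj (datum' Cu μ hC hS).BN)) := rfl

/-- The level of `datum′` is `N` (as for `datum`). [cite: MochizukiEtTh2009, §5 p.323 (PDF p.97)] -/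
theorem datum'_N : (datum' Cu μ hC hS).N = N := rfl

/-- `Π^tp_X̲` of `datum′` is `Π^tp_X̲̲ = Cu.Huu` (as for `datum`). [cite: MochizukiEtTh2009, §5 p.330 (PDF p.104)] -/
theorem datum'_PiX : (datum' Cu μ hC hS).PiX = Cu.Huu := rfl

end CnstToy

end ThetaFrobenioid

end Literature.AnabelianGeometry.EtaleTheta

end
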